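import Mathlib
import Literature.Analysis.FluidPDE.VectorCalculus
import Summits.NavierStokesRegularity.NavierStokesRegularity.Theorems.ThreadingFluxErtelTowerLinearFlowRigidity
import Summits.NavierStokesRegularity.NavierStokesRegularity.Theorems.ThreadingFluxErtelTowerAffineFlowRigidity
import Summits.NavierStokesRegularity.NavierStokesRegularity.Theorems.UnthreadedDoorKinematicShadowPointSourceCalculus
import HarnessLib

/-!
# Crux `PoloidalLiouville` (stmt-NavierStokesRegularity-1222, W1), crux idea «radial-jerk-tower» (ns-idea-15 g7):
# INVISCID LINEAR-FLOW RIGIDITY, III — THE DICHOTOMY: frozen sphere-tangent fields exist ⟺ the linear flow is axisymmetric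

Support file (`--supports stmt-NavierStokesRegularity-1222`, helper).  Experiment cell `ns-wall-extremal`, width hand
ns-wall-eng-5 g8, item (ε) E3 (critic of record ns-wall-crit-1 g6, batch #9: the case split «triaxial / two-rate ω⊥ ≠ 0 / two-rate
ω ∥ axis / isotropic» is exhaustive and the IFF is correct on paper; NO STRIKE).  0 kit.

Files I–II (E1 `…LinearFlowTower`, E2 `…LinearFlowRigidity`) showed: the inviscid shadow of the wall in a linear drift `u = A(x − x₀)`
is rigid as soon as the discriminant cubic `D_A` is not identically zero, and `D_A ≢ 0` whenever the strain `½(A + A†)` is triaxial.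
This file finishes the classification of `A : ℝ³ →L[ℝ] ℝ³`:

* `linDisc_corner_one_zero_one`, `linDisc_corner_zero_one_one` — two more values of the eigenframe cubic;
  ★ `linDisc_exists_ne_zero_of_twoRate` — TWO EQUAL RATES `e₀ = e₁ ≠ e₂` with TILTED SPIN (`⟪u₀, A u₂⟫ ≠ 0` or `⟪u₁, A u₂⟫ ≠ 0`,
  i.e. the background vorticity is not along the strain's symmetry axis) ⇒ `D_A ≢ 0` (critic's `D = −(a−c)²z₃²(ω₁z₁ + ω₂z₂)`);
* `frame_cross` — the cross products of an orthonormal eigenframe (`u₀ × u₁ = ε u₂` cyclically, `ε = ±1` its orientation);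
  `commute_cross_of_twoRate_aligned` — two equal rates with spin ALONG the axis ⇒ `A` commutes with `z ↦ u₂ × z`;
  `eq_smul_add_cross_of_isotropic` / `commute_cross_of_isotropic` — three equal rates ⇒ `A = (e/2)·id + [ω]×` commutes with a
  rotation generator (`[ω]×`, or any if `ω = 0`);
* ★ `linDisc_ne_zero_or_axisymmetric` — for EVERY `A`: either `D_A(v) ≠ 0` for some `v`, or `A` commutes with `z ↦ w × z` for some
  `w ≠ 0` (spectral theorem for `A + A†` + the four cases);
* ★★★ `inviscidLinearFlow_dichotomy` — **THE INVISCID LINEARISED LOCAL WALL AT A GENERAL STAGNATION POINT, DECIDED**: for every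
  velocity gradient `A` and centre `x₀`, a NON-ZERO smooth field frozen into `u = A(x − x₀)` and tangent to the spheres about `x₀`
  exists on some open space-time set IFF the linear flow is AXISYMMETRIC about an axis through `x₀` (`A` commutes with a rotation
  generator `z ↦ w × z`, `w ≠ 0`); the witness is `w × (x − x₀)` (E1), the obstruction is `inviscidKinematicRigidity` BY NAME through
  the discriminant (E1/E2 and the two-rate case here);
* ★★ `affineFlowRigidity_of_nonaxisymmetric` — NON-STAGNATION centres: for the affine drift `v + A(x − x₀)` (file
  `…AffineFlowRigidity`, E4: its discriminant has `D_A` as top-degree part) a non-axisymmetric GRADIENT `A` already forces rigidity,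
  whatever the centre value `v = u(x₀)`.

HONEST FRAME: statements about the INVISCID LINEAR shadow (prescribed linear drift); helper/information-grade; W1 movement 0;
`PoloidalLiouville` (1222) / (27585) OPEN; NS regularity NOT proved.
-/

-- the summit and its single problem share the name (D-0017 nested layout)
set_option linter.dupNamespace false

noncomputable section

namespace Summit.NavierStokesRegularity.NavierStokesRegularity.Theorems.PoloidalLiouville.ErtelTower

open Set Function
open scoped Topology RealInnerProductSpace InnerProductSpace
open Literature.Analysis.FluidPDE
open Summit.NavierStokesRegularity.NavierStokesRegularity.Theorems.PoloidalLiouville.HorizonTower (E3)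
open Summit.NavierStokesRegularity.NavierStokesRegularity.Theorems.PoloidalLiouville.CentreJet.TriaxialFrame
  (exists_orthonormalBasis_eq)

section TwoRate

variable {A : E3 →L[ℝ] E3} {u : Fin 3 → E3} {e : Fin 3 → ℝ} {ob : OrthonormalBasis (Fin 3) ℝ E3}

/-- The eigenframe cubic at the corner `(1,0,1)`: `ε·(e₀−e₂)·((e₀−e₁)w₀₁ + (e₁−e₂)w₁₂)`. -/
theorem linDisc_corner_one_zero_one (hu : Orthonormal ℝ u) (hob : ∀ i, ob i = u i)
    (hM : ∀ i, (A + ContinuousLinearMap.adjoint A) (u i) = e i • u i) {ε : ℝ} (hε1 : ε = 1 ∨ ε = -1)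
    (hε : ∀ a b : E3, cross (ob.repr a) (ob.repr b) = ε • ob.repr (cross a b)) :
    ⟪ob.repr.symm (WithLp.toLp 2 ![1, 0, 1]),
        cross ((A + ContinuousLinearMap.adjoint A) (ob.repr.symm (WithLp.toLp 2 ![1, 0, 1])))
          ((ContinuousLinearMap.adjoint A) ((A + ContinuousLinearMap.adjoint A) (ob.repr.symm (WithLp.toLp 2 ![1, 0, 1])))
            + (A + ContinuousLinearMap.adjoint A) (A (ob.repr.symm (WithLp.toLp 2 ![1, 0, 1]))))⟫
      = ε * ((e 0 - e 2) * ((e 0 - e 1) * ⟪u 0, A (u 1)⟫ + (e 1 - e 2) * ⟪u 1, A (u 2)⟫)) := by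
  rw [linDisc_symm_coord hu hob hM hε1 hε]
  simp only [Matrix.cons_val_zero, Matrix.cons_val_one, Matrix.cons_val_two, Matrix.head_cons, Matrix.tail_cons]
  ring

/-- The eigenframe cubic at the corner `(0,1,1)`: `−ε·(e₁−e₂)·((e₀−e₁)w₀₁ + (e₀−e₂)w₀₂)`. -/
theorem linDisc_corner_zero_one_one (hu : Orthonormal ℝ u) (hob : ∀ i, ob i = u i)
    (hM : ∀ i, (A + ContinuousLinearMap.adjoint A) (u i) = e i • u i) {ε : ℝ} (hε1 : ε = 1 ∨ ε = -1)
    (hε : ∀ a b : E3, cross (ob.repr a) (ob.repr b) = ε • ob.repr (cross a b)) :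
    ⟪ob.repr.symm (WithLp.toLp 2 ![0, 1, 1]),
        cross ((A + ContinuousLinearMap.adjoint A) (ob.repr.symm (WithLp.toLp 2 ![0, 1, 1])))
          ((ContinuousLinearMap.adjoint A) ((A + ContinuousLinearMap.adjoint A) (ob.repr.symm (WithLp.toLp 2 ![0, 1, 1])))
            + (A + ContinuousLinearMap.adjoint A) (A (ob.repr.symm (WithLp.toLp 2 ![0, 1, 1]))))⟫
      = -(ε * ((e 1 - e 2) * ((e 0 - e 1) * ⟪u 0, A (u 1)⟫ + (e 0 - e 2) * ⟪u 0, A (u 2)⟫))) := by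
  rw [linDisc_symm_coord hu hob hM hε1 hε]
  simp only [Matrix.cons_val_zero, Matrix.cons_val_one, Matrix.cons_val_two, Matrix.head_cons, Matrix.tail_cons]
  ring

/-- ★ **TWO EQUAL RATES WITH TILTED SPIN ⇒ the discriminant is not identically zero.**  If `A + A†` has an orthonormal
eigenframe with `e₀ = e₁ ≠ e₂` and the spin is NOT along the symmetry axis `u₂` (`⟪u₀, A u₂⟫ ≠ 0` or `⟪u₁, A u₂⟫ ≠ 0`), then
`D_A(v) ≠ 0` for some `v` (namely `D_A(R⁻¹(1,0,1)) = ε(e₁−e₂)²⟪u₁, A u₂⟫`, `D_A(R⁻¹(0,1,1)) = −ε(e₁−e₂)²⟪u₀, A u₂⟫`). -/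
theorem linDisc_exists_ne_zero_of_twoRate (A : E3 →L[ℝ] E3) (u : Fin 3 → E3) (e : Fin 3 → ℝ) (hu : Orthonormal ℝ u)
    (h01 : e 0 = e 1) (h12 : e 1 ≠ e 2) (hM : ∀ i, (A + ContinuousLinearMap.adjoint A) (u i) = e i • u i)
    (htilt : ⟪u 0, A (u 2)⟫ ≠ 0 ∨ ⟪u 1, A (u 2)⟫ ≠ 0) :
    ∃ v : E3, ⟪v, cross ((A + ContinuousLinearMap.adjoint A) v)
      ((ContinuousLinearMap.adjoint A) ((A + ContinuousLinearMap.adjoint A) v)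
        + (A + ContinuousLinearMap.adjoint A) (A v))⟫ ≠ 0 := by
  obtain ⟨ob, hob⟩ := exists_orthonormalBasis_eq hu
  obtain ⟨ε, hε1, hε⟩ := exists_sign_cross_map ob.repr
  have hε0 : ε ≠ 0 := by rcases hε1 with h | h <;> simp [h]
  have h12' : e 1 - e 2 ≠ 0 := sub_ne_zero.mpr h12
  rcases htilt with h02 | h12t
  · refine ⟨ob.repr.symm (WithLp.toLp 2 ![0, 1, 1]), ?_⟩
    rw [linDisc_corner_zero_one_one hu hob hM hε1 hε, h01, sub_self, zero_mul, zero_add]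
    exact neg_ne_zero.mpr (mul_ne_zero hε0 (mul_ne_zero h12' (mul_ne_zero h12' h02)))
  · refine ⟨ob.repr.symm (WithLp.toLp 2 ![1, 0, 1]), ?_⟩
    rw [linDisc_corner_one_zero_one hu hob hM hε1 hε, h01, sub_self, zero_mul, zero_add]
    exact mul_ne_zero hε0 (mul_ne_zero h12' (mul_ne_zero h12' h12t))

end TwoRate

/-! ### The degenerate (axisymmetric) classes: `A` commutes with a rotation generator -/

section Degenerate

variable {A : E3 →L[ℝ] E3} {u : Fin 3 → E3} {e : Fin 3 → ℝ} {ob : OrthonormalBasis (Fin 3) ℝ E3}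

/-- The standard cross products `e₀ × e₁ = e₂`, `e₁ × e₂ = e₀`, `e₂ × e₀ = e₁`. -/
theorem cross_single_cyclic :
    cross (EuclideanSpace.single (0 : Fin 3) (1 : ℝ)) (EuclideanSpace.single 1 1) = EuclideanSpace.single 2 1 ∧
    cross (EuclideanSpace.single (1 : Fin 3) (1 : ℝ)) (EuclideanSpace.single 2 1) = EuclideanSpace.single 0 1 ∧
    cross (EuclideanSpace.single (2 : Fin 3) (1 : ℝ)) (EuclideanSpace.single 0 1) = EuclideanSpace.single 1 1 := by
  refine ⟨?_, ?_, ?_⟩ <;> ext i <;> fin_cases i <;> simp [cross, cross_apply]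

/-- **Cross products of an orthonormal eigenframe**: `u₀ × u₁ = ε u₂`, `u₁ × u₂ = ε u₀`, `u₂ × u₀ = ε u₁` with `ε = ±1` the
orientation sign of the frame. -/
theorem frame_cross (hob : ∀ i, ob i = u i) {ε : ℝ} (hε1 : ε = 1 ∨ ε = -1)
    (hε : ∀ a b : E3, cross (ob.repr a) (ob.repr b) = ε • ob.repr (cross a b)) :
    cross (u 0) (u 1) = ε • u 2 ∧ cross (u 1) (u 2) = ε • u 0 ∧ cross (u 2) (u 0) = ε • u 1 := by
  classical
  have hεsq : ε * ε = 1 := by rcases hε1 with h | h <;> simp [h]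
  obtain ⟨c01, c12, c20⟩ := cross_single_cyclic
  have key : ∀ i j k : Fin 3,
      cross (EuclideanSpace.single i (1 : ℝ)) (EuclideanSpace.single j 1) = EuclideanSpace.single k 1 →
        cross (u i) (u j) = ε • u k := by
    intro i j k hc
    have h := hε (u i) (u j)
    rw [← hob i, ← hob j, ob.repr_self, ob.repr_self, hc] at h
    -- `single k 1 = ε • R (uᵢ × uⱼ)` ⇒ `uᵢ × uⱼ = ε • R⁻¹ (single k 1) = ε • u k`
    have h2 := congrArg (fun w => ε • ob.repr.symm w) h
    simp only [map_smul, LinearIsometryEquiv.symm_apply_apply, smul_smul, hεsq, one_smul, ob.repr_symm_single, hob] at h2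
    exact h2.symm
  exact ⟨key 0 1 2 c01, key 1 2 0 c12, key 2 0 1 c20⟩

/-- Two continuous linear maps that agree on the frame agree everywhere. -/
theorem clm_eq_of_frame (hob : ∀ i, ob i = u i) {F G : E3 →L[ℝ] E3} (h : ∀ i, F (u i) = G (u i)) (z : E3) :
    F z = G z := by
  rw [← ob.sum_repr' z]
  simp only [map_sum, map_smul, hob, h]

/-- Expansion of `A uⱼ` in the frame: `A uⱼ = Σᵢ ⟪uᵢ, A uⱼ⟫ uᵢ`. -/
theorem frame_expand (hob : ∀ i, ob i = u i) (v : E3) : v = ⟪u 0, v⟫ • u 0 + ⟪u 1, v⟫ • u 1 + ⟪u 2, v⟫ • u 2 := by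
  conv_lhs => rw [← ob.sum_repr' v]
  simp only [Fin.sum_univ_three, hob]

/-- Linearity of `z ↦ w × z` on a frame combination. -/
theorem cross_frame_comb (w p q r : E3) (a b c : ℝ) :
    cross w (a • p + b • q + c • r) = a • cross w p + b • cross w q + c • cross w r := by
  simp only [← crossCLM_apply, map_add, map_smul]

/-- **TWO EQUAL RATES WITH ALIGNED SPIN ⇒ axisymmetric.**  If `A + A†` has an orthonormal eigenframe with `e₀ = e₁` and the spin is
along `u₂` (`⟪u₀, A u₂⟫ = ⟪u₁, A u₂⟫ = 0`), then `A` commutes with the rotation generator `z ↦ u₂ × z`. -/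
theorem commute_cross_of_twoRate_aligned (hu : Orthonormal ℝ u) (h01 : e 0 = e 1)
    (hM : ∀ i, (A + ContinuousLinearMap.adjoint A) (u i) = e i • u i) (h02 : ⟪u 0, A (u 2)⟫ = 0) (h12 : ⟪u 1, A (u 2)⟫ = 0)
    (z : E3) : A (cross (u 2) z) = cross (u 2) (A z) := by
  obtain ⟨ob, hob⟩ := exists_orthonormalBasis_eq hu
  obtain ⟨ε, hε1, hε⟩ := exists_sign_cross_map ob.repr
  obtain ⟨-, c12, c20⟩ := frame_cross hob hε1 hε
  have c21 : cross (u 2) (u 1) = -(ε • u 0) := by rw [KinematicShadow.PointSource.cross_anticomm, c12]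
  -- frame entries
  have h := inner_frame_add_swap hu hM
  have h00 := h 0 0; have h11 := h 1 1; have h22 := h 2 2
  have g01 := h 0 1; have g02 := h 0 2; have g12 := h 1 2
  simp only [if_true] at h00 h11 h22
  simp only [show (0 : Fin 3) ≠ 1 by decide, show (0 : Fin 3) ≠ 2 by decide, show (1 : Fin 3) ≠ 2 by decide,
    if_false] at g01 g02 g12
  set a01 : ℝ := ⟪u 0, A (u 1)⟫ with ha01
  set a22 : ℝ := ⟪u 2, A (u 2)⟫ with ha22
  have s10 : ⟪u 1, A (u 0)⟫ = -a01 := by linarith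
  have s20 : ⟪u 2, A (u 0)⟫ = 0 := by linarith
  have s21 : ⟪u 2, A (u 1)⟫ = 0 := by linarith
  have s00 : ⟪u 0, A (u 0)⟫ = e 0 / 2 := by linarith
  have s11 : ⟪u 1, A (u 1)⟫ = e 0 / 2 := by rw [h01]; linarith
  have eA0 := frame_expand hob (A (u 0))
  have eA1 := frame_expand hob (A (u 1))
  have eA2 := frame_expand hob (A (u 2))
  rw [s00, s10, s20] at eA0
  rw [← ha01, s11, s21] at eA1
  rw [h02, h12, ← ha22] at eA2
  -- compare the two linear maps on the frame
  refine clm_eq_of_frame hob (F := A.comp (crossCLM (u 2))) (G := (crossCLM (u 2)).comp A) (fun i => ?_) z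
  simp only [ContinuousLinearMap.comp_apply, crossCLM_apply]
  fin_cases i
  · show A (cross (u 2) (u 0)) = cross (u 2) (A (u 0))
    rw [c20, map_smul, eA1, eA0, cross_frame_comb, c20, c21, KinematicShadow.PointSource.cross_self]
    module
  · show A (cross (u 2) (u 1)) = cross (u 2) (A (u 1))
    rw [c21, map_neg, map_smul, eA0, eA1, cross_frame_comb, c20, c21, KinematicShadow.PointSource.cross_self]
    module
  · show A (cross (u 2) (u 2)) = cross (u 2) (A (u 2))
    rw [KinematicShadow.PointSource.cross_self, map_zero, eA2, cross_frame_comb, c20, c21, KinematicShadow.PointSource.cross_self]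
    module

/-- **THREE EQUAL RATES ⇒ `A = (e/2)·id + [ω]×`** with `ω = ε(⟪u₂, A u₁⟫ u₀ + ⟪u₀, A u₂⟫ u₁ + ⟪u₁, A u₀⟫ u₂)`. -/
theorem eq_smul_add_cross_of_isotropic (hu : Orthonormal ℝ u) (h01 : e 0 = e 1) (h12 : e 1 = e 2)
    (hM : ∀ i, (A + ContinuousLinearMap.adjoint A) (u i) = e i • u i) :
    ∃ ω : E3, ∀ z : E3, A z = (e 0 / 2) • z + cross ω z := by
  obtain ⟨ob, hob⟩ := exists_orthonormalBasis_eq hu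
  obtain ⟨ε, hε1, hε⟩ := exists_sign_cross_map ob.repr
  have hεsq : ε * ε = 1 := by rcases hε1 with h | h <;> simp [h]
  obtain ⟨c01, c12, c20⟩ := frame_cross hob hε1 hε
  have c10 : cross (u 1) (u 0) = -(ε • u 2) := by rw [KinematicShadow.PointSource.cross_anticomm, c01]
  have c21 : cross (u 2) (u 1) = -(ε • u 0) := by rw [KinematicShadow.PointSource.cross_anticomm, c12]
  have c02 : cross (u 0) (u 2) = -(ε • u 1) := by rw [KinematicShadow.PointSource.cross_anticomm, c20]
  have h := inner_frame_add_swap hu hM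
  have h00 := h 0 0; have h11 := h 1 1; have h22 := h 2 2
  have g01 := h 0 1; have g02 := h 0 2; have g12 := h 1 2
  simp only [if_true] at h00 h11 h22
  simp only [show (0 : Fin 3) ≠ 1 by decide, show (0 : Fin 3) ≠ 2 by decide, show (1 : Fin 3) ≠ 2 by decide,
    if_false] at g01 g02 g12
  set a10 : ℝ := ⟪u 1, A (u 0)⟫ with ha10
  set a02 : ℝ := ⟪u 0, A (u 2)⟫ with ha02
  set a21 : ℝ := ⟪u 2, A (u 1)⟫ with ha21
  have s01 : ⟪u 0, A (u 1)⟫ = -a10 := by linarith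
  have s20 : ⟪u 2, A (u 0)⟫ = -a02 := by linarith
  have s12 : ⟪u 1, A (u 2)⟫ = -a21 := by linarith
  have s00 : ⟪u 0, A (u 0)⟫ = e 0 / 2 := by linarith
  have s11 : ⟪u 1, A (u 1)⟫ = e 0 / 2 := by rw [h01]; linarith
  have s22 : ⟪u 2, A (u 2)⟫ = e 0 / 2 := by rw [h01, h12]; linarith
  have eA0 := frame_expand hob (A (u 0))
  have eA1 := frame_expand hob (A (u 1))
  have eA2 := frame_expand hob (A (u 2))
  rw [s00, ← ha10, s20] at eA0
  rw [s01, s11, ← ha21] at eA1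
  rw [← ha02, s12, s22] at eA2
  refine ⟨ε • (a21 • u 0 + a02 • u 1 + a10 • u 2), fun z => ?_⟩
  -- the cross products of `ω` with the frame vectors
  have hω : ∀ v : E3, cross (ε • (a21 • u 0 + a02 • u 1 + a10 • u 2)) v
      = ε • (a21 • cross (u 0) v + a02 • cross (u 1) v + a10 • cross (u 2) v) := fun v => by
    simp only [← crossCLM_apply, map_add, map_smul, add_apply, smul_apply]
  refine clm_eq_of_frame hob (F := A)
    (G := (e 0 / 2) • ContinuousLinearMap.id ℝ E3 + crossCLM (ε • (a21 • u 0 + a02 • u 1 + a10 • u 2))) (fun i => ?_) z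
  rw [add_apply, smul_apply, ContinuousLinearMap.id_apply, crossCLM_apply, hω]
  fin_cases i
  · show A (u 0) = (e 0 / 2) • u 0 + ε • (a21 • cross (u 0) (u 0) + a02 • cross (u 1) (u 0) + a10 • cross (u 2) (u 0))
    rw [eA0, KinematicShadow.PointSource.cross_self, c10, c20]
    rcases hε1 with rfl | rfl <;> module
  · show A (u 1) = (e 0 / 2) • u 1 + ε • (a21 • cross (u 0) (u 1) + a02 • cross (u 1) (u 1) + a10 • cross (u 2) (u 1))
    rw [eA1, c01, KinematicShadow.PointSource.cross_self, c21]
    rcases hε1 with rfl | rfl <;> module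
  · show A (u 2) = (e 0 / 2) • u 2 + ε • (a21 • cross (u 0) (u 2) + a02 • cross (u 1) (u 2) + a10 • cross (u 2) (u 2))
    rw [eA2, c02, c12, KinematicShadow.PointSource.cross_self]
    rcases hε1 with rfl | rfl <;> module

/-- `a × (b × c)` versus a scalar shift: if `A = λ·id + [ω]×` then `A` commutes with `[ω]×`. -/
theorem commute_cross_of_eq_smul_add_cross {lam : ℝ} {ω : E3} (hA : ∀ z : E3, A z = lam • z + cross ω z) (z : E3) :
    A (cross ω z) = cross ω (A z) := by
  rw [hA, hA z]
  simp only [← crossCLM_apply, map_add, map_smul]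

/-- **THREE EQUAL RATES ⇒ axisymmetric**: `A` commutes with SOME rotation generator `z ↦ w × z`, `w ≠ 0`. -/
theorem commute_cross_of_isotropic (hu : Orthonormal ℝ u) (h01 : e 0 = e 1) (h12 : e 1 = e 2)
    (hM : ∀ i, (A + ContinuousLinearMap.adjoint A) (u i) = e i • u i) :
    ∃ w : E3, w ≠ 0 ∧ ∀ z : E3, A (cross w z) = cross w (A z) := by
  obtain ⟨ω, hω⟩ := eq_smul_add_cross_of_isotropic hu h01 h12 hM
  by_cases hω0 : ω = 0
  · -- `A = (e/2)·id` commutes with everything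
    refine ⟨u 0, hu.ne_zero 0, fun z => ?_⟩
    rw [hω, hω z, hω0]
    simp only [← crossCLM_apply, map_zero, zero_apply, add_zero, map_smul]
  · exact ⟨ω, hω0, commute_cross_of_eq_smul_add_cross hω⟩

end Degenerate

/-! ### The classification of `A` and the dichotomy -/

section Dichotomy

/-- Relabelling a frame by an injective self-map of `Fin 3` keeps it an orthonormal eigenframe. -/
theorem frame_relabel {A : E3 →L[ℝ] E3} {u : Fin 3 → E3} {e : Fin 3 → ℝ} (σ : Fin 3 → Fin 3) (hσ : Function.Injective σ)
    (hu : Orthonormal ℝ u) (hM : ∀ i, (A + ContinuousLinearMap.adjoint A) (u i) = e i • u i) :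
    Orthonormal ℝ (u ∘ σ) ∧ ∀ i, (A + ContinuousLinearMap.adjoint A) ((u ∘ σ) i) = (e ∘ σ) i • (u ∘ σ) i :=
  ⟨hu.comp σ hσ, fun i => hM (σ i)⟩

/-- ★ **The classification.**  For every `A : ℝ³ →L[ℝ] ℝ³`: either the discriminant cubic `D_A` is non-zero somewhere, or `A`
commutes with a rotation generator `z ↦ w × z` for some `w ≠ 0` (the linear flow `A z` is axisymmetric about `ℝw`).
Spectral theorem for `A + A†`, then: three distinct rates (E2) / two equal rates with tilted spin (`…of_twoRate`) give the
first alternative; two equal rates with aligned spin / three equal rates give the second. -/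
theorem linDisc_ne_zero_or_axisymmetric (A : E3 →L[ℝ] E3) :
    (∃ v : E3, ⟪v, cross ((A + ContinuousLinearMap.adjoint A) v)
      ((ContinuousLinearMap.adjoint A) ((A + ContinuousLinearMap.adjoint A) v)
        + (A + ContinuousLinearMap.adjoint A) (A v))⟫ ≠ 0) ∨
    (∃ w : E3, w ≠ 0 ∧ ∀ z : E3, A (cross w z) = cross w (A z)) := by
  -- an orthonormal eigenframe of the symmetrised gradient
  have hsym : ((A + ContinuousLinearMap.adjoint A : E3 →L[ℝ] E3) : E3 →ₗ[ℝ] E3).IsSymmetric :=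
    (ContinuousLinearMap.isSelfAdjoint_iff_isSymmetric.mp (by
      rw [ContinuousLinearMap.isSelfAdjoint_iff']
      exact adjoint_symmPart A))
  have hn : Module.finrank ℝ E3 = 3 := by simp
  set b := hsym.eigenvectorBasis hn with hbdef
  set ev : Fin 3 → ℝ := hsym.eigenvalues hn with hevdef
  have hM : ∀ i, (A + ContinuousLinearMap.adjoint A) (b i) = ev i • b i := fun i => hsym.apply_eigenvectorBasis hn i
  have hu : Orthonormal ℝ (⇑b) := b.orthonormal
  -- the generic alternatives, for any relabelled frame with the pattern `e₀ = e₁ ≠ e₂`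
  have twoRate : ∀ (u : Fin 3 → E3) (e : Fin 3 → ℝ), Orthonormal ℝ u →
      (∀ i, (A + ContinuousLinearMap.adjoint A) (u i) = e i • u i) → e 0 = e 1 → e 1 ≠ e 2 →
      (∃ v : E3, ⟪v, cross ((A + ContinuousLinearMap.adjoint A) v)
        ((ContinuousLinearMap.adjoint A) ((A + ContinuousLinearMap.adjoint A) v)
          + (A + ContinuousLinearMap.adjoint A) (A v))⟫ ≠ 0) ∨
      (∃ w : E3, w ≠ 0 ∧ ∀ z : E3, A (cross w z) = cross w (A z)) := by
    intro u e hu' hM' h01 h12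
    by_cases htilt : ⟪u 0, A (u 2)⟫ ≠ 0 ∨ ⟪u 1, A (u 2)⟫ ≠ 0
    · exact Or.inl (linDisc_exists_ne_zero_of_twoRate A u e hu' h01 h12 hM' htilt)
    · push Not at htilt
      exact Or.inr ⟨u 2, hu'.ne_zero 2, commute_cross_of_twoRate_aligned hu' h01 hM' htilt.1 htilt.2⟩
  by_cases h01 : ev 0 = ev 1
  · by_cases h12 : ev 1 = ev 2
    · exact Or.inr (commute_cross_of_isotropic hu h01 h12 hM)
    · exact twoRate (⇑b) ev hu hM h01 h12
  · by_cases h12 : ev 1 = ev 2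
    · -- relabel `(1,2,0)`: `e₁ = e₂ ≠ e₀`
      obtain ⟨hu', hM'⟩ := frame_relabel ![1, 2, 0] (by decide) hu hM
      exact twoRate (⇑b ∘ ![1, 2, 0]) (ev ∘ ![1, 2, 0]) hu' hM' (by simpa using h12)
        (by simpa using fun h : ev 2 = ev 0 => h01 (h12.trans h).symm)
    · by_cases h02 : ev 0 = ev 2
      · -- relabel `(2,0,1)`: `e₂ = e₀ ≠ e₁`
        obtain ⟨hu', hM'⟩ := frame_relabel ![2, 0, 1] (by decide) hu hM
        exact twoRate (⇑b ∘ ![2, 0, 1]) (ev ∘ ![2, 0, 1]) hu' hM' (by simpa using h02.symm) (by simpa using h01)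
      · -- three distinct rates
        refine Or.inl (linDisc_exists_ne_zero_of_triaxial A (⇑b) ev hu (fun i j hij => ?_) hM)
        fin_cases i <;> fin_cases j <;> simp_all

/-- A non-zero vector has a non-zero cross product with some vector. -/
theorem exists_cross_ne_zero {w : E3} (hw : w ≠ 0) : ∃ v : E3, cross w v ≠ 0 := by
  by_contra h
  push Not at h
  have h0 := h (EuclideanSpace.single 0 1)
  have h1 := h (EuclideanSpace.single 1 1)
  apply hw
  have c0 : w 1 = 0 ∧ w 2 = 0 := by
    have := congrArg (fun v : E3 => (v 1, v 2)) h0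
    simp [cross, cross_apply] at this
    exact ⟨this.2, this.1⟩
  have c1 : w 0 = 0 := by
    have := congrArg (fun v : E3 => v 2) h1
    simpa [cross, cross_apply] using this
  ext i
  fin_cases i
  · simpa using c1
  · simpa using c0.1
  · simpa using c0.2

/-- ★★★ **THE INVISCID LINEARISED LOCAL WALL AT A GENERAL STAGNATION POINT, DECIDED.**  For every velocity gradient
`A : ℝ³ →L[ℝ] ℝ³` and every centre `x₀`: there is a smooth field `B`, frozen into the linear drift `u = A(x − x₀)`
(`∂ₜB + DB[A(x − x₀)] − A B = 0`) and tangent to the spheres about `x₀` on some open `I × U`, which is NOT identically zero there,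
IF AND ONLY IF the linear flow is AXISYMMETRIC about an axis through `x₀`: `A` commutes with a rotation generator `z ↦ w × z`,
`w ≠ 0`.  (⇒: otherwise `linDisc_ne_zero_or_axisymmetric` gives `D_A ≢ 0` and `linearFlowRigidity_of_ne_zero`
— `inviscidKinematicRigidity` by name — kills `B`; ⇐: the steady witness `w × (x − x₀)` of `linearFlow_frozen_witness`.) -/
theorem inviscidLinearFlow_dichotomy (A : E3 →L[ℝ] E3) (x₀ : E3) :
    (∃ (B : ℝ → E3 → E3) (I : Set ℝ) (U : Set E3), IsOpen I ∧ IsOpen U ∧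
        ContDiffOn ℝ (⊤ : ℕ∞) (uncurry B) (I ×ˢ U) ∧
        (∀ t ∈ I, ∀ x ∈ U, deriv (fun s => B s x) t + fderiv ℝ (B t) x (A (x - x₀)) - A (B t x) = 0) ∧
        (∀ t ∈ I, ∀ x ∈ U, ⟪B t x, x - x₀⟫ = 0) ∧ ∃ t ∈ I, ∃ x ∈ U, B t x ≠ 0) ↔
    ∃ w : E3, w ≠ 0 ∧ ∀ z : E3, A (cross w z) = cross w (A z) := by
  constructor
  · rintro ⟨B, I, U, hI, hU, hB, hfrozen, htan, t, ht, x, hx, hne⟩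
    rcases linDisc_ne_zero_or_axisymmetric A with ⟨v, hv⟩ | hax
    · exact absurd (linearFlowRigidity_of_ne_zero A x₀ B I U hI hU hB hfrozen htan hv t ht x hx) hne
    · exact hax
  · rintro ⟨w, hw, hcomm⟩
    obtain ⟨hfro, htan⟩ := linearFlow_frozen_witness A x₀ w hcomm
    obtain ⟨v, hv⟩ := exists_cross_ne_zero hw
    refine ⟨fun _ x => cross w (x - x₀), univ, univ, isOpen_univ, isOpen_univ, ?_, fun t _ x _ => hfro t x,
      fun t _ x _ => htan x, 0, mem_univ _, x₀ + v, mem_univ _, by simpa using hv⟩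
    exact ((crossCLM w).contDiff.comp (contDiff_snd.sub contDiff_const)).contDiffOn

/-- ★★ **INVISCID AFFINE-FLOW RIGIDITY FOR NON-AXISYMMETRIC GRADIENTS.**  Let `u = v + A(x − x₀)` be any affine drift whose
gradient `A` commutes with NO rotation generator `z ↦ w × z` (`w ≠ 0`).  Then — whatever the value `v = u(x₀)` — no non-zero smooth
field frozen into `u` on an open space-time set stays tangent to the spheres about `x₀`.  (`linDisc_ne_zero_or_axisymmetric` gives `D_A ≢ 0`; the affine discriminant of file `…AffineFlowRigidity` has `D_A` as its
top-degree part, so it is non-zero on a dense set; `inviscidKinematicRigidity` by name.) -/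
theorem affineFlowRigidity_of_nonaxisymmetric (v : E3) (A : E3 →L[ℝ] E3) (x₀ : E3) (B : ℝ → E3 → E3) (I : Set ℝ) (U : Set E3)
    (hA : ¬ ∃ w : E3, w ≠ 0 ∧ ∀ z : E3, A (cross w z) = cross w (A z)) (hI : IsOpen I) (hU : IsOpen U)
    (hB : ContDiffOn ℝ (⊤ : ℕ∞) (uncurry B) (I ×ˢ U))
    (hfrozen : ∀ t ∈ I, ∀ x ∈ U, deriv (fun s => B s x) t + fderiv ℝ (B t) x (v + A (x - x₀)) - A (B t x) = 0)
    (htan : ∀ t ∈ I, ∀ x ∈ U, ⟪B t x, x - x₀⟫ = 0) :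
    ∀ t ∈ I, ∀ x ∈ U, B t x = 0 := by
  rcases linDisc_ne_zero_or_axisymmetric A with ⟨d, hd⟩ | hax
  · exact affineFlowRigidity_of_ne_zero v A x₀ B I U hI hU hB hfrozen htan hd
  · exact absurd hax hA

end Dichotomy

end Summit.NavierStokesRegularity.NavierStokesRegularity.Theorems.PoloidalLiouville.ErtelTower

end
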